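import Summits.AtomisticToContinuum.BoseEinsteinCondensation.Theorems.BECThomsonPrincipleFibreFubini
import Summits.AtomisticToContinuum.BoseEinsteinCondensation.Theorems.GaussianDominationCan.Negative.CruxForms
import HarnessLib

/-!
# Route `BECThomsonPrinciple`, crux `FibreConductance` (stmt-AtomisticToContinuum-9480),
# line `parseval-shell-bootstrap` — stub `stub_transport`, part I: the transport flow

The explicit TRANSPORT FLOW of the line, `J₀ = L^{-3/2} e^{ik·x₀} ψ k/(i|k|²)` (here as
`X l ↦ a_l · e^{ik·x₀} ψ(X)` with `a_l = L^{-3/2} k_l/(i|k|²)`, `k_l = 2πn_l/L`, `ψ = fibrePsi Φ`):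

* its weak `x₀`-divergence is `Σ_l a_l ∂_{0,l}(e^{ik·x₀}ψ)` (`tr_hasWeakDiv_transport`: periodic
  integration by parts in the fibre variable, `integral_cellN_fderiv_zero`, and the product rule
  `∂_{0,l}(e^{ik·x₀}ψ) = e^{ik·x₀}(∂_{0,l}ψ + ik_lψ)`), which is POINTWISE the crux's charge plus the
  two defect charges, `q + ε♭ + ε♮` (`tr_div_identity`, pure algebra: `Σ_l k_l² = |k|²`);
* its cost is EXACTLY `|k|⁻² = L²/(4π²|n|₂²) ≤ L²/(4π²‖n‖²)` (`tr_cost_transport`, from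
  `∫_{cell^N} W = L³`).

Part II (`BECThomsonPrincipleFibreConductanceStubTransport`) glues the correctors and proves the
registered stub `stub_transport`.  Registered anchor (`--supports` the crux item):
`tr_cost_transport`.

References: the line card `Cruxes/FibreConductance/Lines/parseval-shell-bootstrap.md`;
R. Lyons, Y. Peres, *Probability on Trees and Networks* (2016), Ch. 2 (Thomson's principle) —
used only as the idea.
-/

noncomputable section

namespace Summit.AtomisticToContinuum.BoseEinsteinCondensation.Cruxes.FibreConductance.ParsevalShellBootstrap

open MeasureTheory
open scoped ENNReal
open Literature.MathematicalPhysics.QuantumManyBody.BoseGas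
open Summit.AtomisticToContinuum.BoseEinsteinCondensation.Theorems.GaussianDominationCan.Negative
  (one_le_norm_intVec)

variable {m : ℕ} {L : ℝ}

/-! ### Periodic integration by parts against a product -/

/-- `∫ f ∂_{0,l} g = -∫ (∂_{0,l} f) g` on the torus for `C¹` functions periodic in particle `0`
(product rule + `integral_cellN_fderiv_zero`). [folklore] -/
private theorem tr_integral_mul_fderiv (hL : 0 < L) {f g : Config (m + 1) → ℂ}
    (hf : ContDiff ℝ 1 f) (hg : ContDiff ℝ 1 g)
    (hfp : ∀ (X : Config (m + 1)) (k : Fin 3),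
      f (X + Pi.single (0 : Fin (m + 1)) (EuclideanSpace.single k L)) = f X)
    (hgp : ∀ (X : Config (m + 1)) (k : Fin 3),
      g (X + Pi.single (0 : Fin (m + 1)) (EuclideanSpace.single k L)) = g X)
    (l : Fin 3) :
    ∫ X in cellN (m + 1) L, f X * fderiv ℝ g X (Pi.single 0 (EuclideanSpace.single l 1)) =
      -∫ X in cellN (m + 1) L, fderiv ℝ f X (Pi.single 0 (EuclideanSpace.single l 1)) * g X := by
  have hfd := hf.differentiable one_ne_zero
  have hgd := hg.differentiable one_ne_zero
  have hIBP := integral_cellN_fderiv_zero hL (hf.mul hg) (fun X k => by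
    show f _ * g _ = f X * g X
    rw [hfp, hgp]) l
  have hprod : ∀ X, fderiv ℝ (fun Y => f Y * g Y) X (Pi.single 0 (EuclideanSpace.single l 1)) =
      f X * fderiv ℝ g X (Pi.single 0 (EuclideanSpace.single l 1)) +
        fderiv ℝ f X (Pi.single 0 (EuclideanSpace.single l 1)) * g X := by
    intro X
    rw [fderiv_fun_mul (hfd X) (hgd X), _root_.add_apply, _root_.smul_apply, _root_.smul_apply,
      smul_eq_mul, smul_eq_mul, mul_comm (g X)]
  simp_rw [hprod] at hIBP
  have hi1 : IntegrableOn
      (fun X => f X * fderiv ℝ g X (Pi.single 0 (EuclideanSpace.single l 1))) (cellN (m + 1) L) :=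
    integrableOn_cellN
      (hf.continuous.mul ((hg.continuous_fderiv one_ne_zero).clm_apply continuous_const)) L
  have hi2 : IntegrableOn
      (fun X => fderiv ℝ f X (Pi.single 0 (EuclideanSpace.single l 1)) * g X) (cellN (m + 1) L) :=
    integrableOn_cellN
      (((hf.continuous_fderiv one_ne_zero).clm_apply continuous_const).mul hg.continuous) L
  rw [integral_add hi1 hi2] at hIBP
  linear_combination hIBP

/-! ### The transport amplitude `P = e^{ik·x₀} ψ` -/

/-- `X ↦ e^{ik·x₀}` is smooth. [folklore] -/
theorem tr_contDiff_phase0 (L : ℝ) (n : Fin 3 → ℤ) {k : WithTop ℕ∞} :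
    ContDiff ℝ k fun X : Config (m + 1) => phase L n (X 0) :=
  (contDiff_phase L n).comp (contDiff_apply ℝ Space 0)

/-- `P = e^{ik·x₀} ψ` is `C¹`. [folklore] -/
private theorem tr_contDiff_P (hL : 0 < L) (n : Fin 3 → ℤ) (Φ : PeriodicTrialState (m + 1) L)
    (hΦ : ∀ X, Φ.ψ X ≠ 0) :
    ContDiff ℝ 1 fun X : Config (m + 1) => phase L n (X 0) * (fibrePsi Φ X : ℂ) :=
  (tr_contDiff_phase0 L n).mul (Complex.ofRealCLM.contDiff.comp (contDiff_fibrePsi hL Φ hΦ))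

/-- `P` is periodic in particle `0`. [folklore] -/
private theorem tr_P_periodic (hL : 0 < L) (n : Fin 3 → ℤ) (Φ : PeriodicTrialState (m + 1) L)
    (X : Config (m + 1)) (k : Fin 3) :
    phase L n ((X + Pi.single (0 : Fin (m + 1)) (EuclideanSpace.single k L) : Config (m + 1)) 0) *
        (fibrePsi Φ (X + Pi.single (0 : Fin (m + 1)) (EuclideanSpace.single k L)) : ℂ) =
      phase L n (X 0) * (fibrePsi Φ X : ℂ) := by
  rw [fibrePsi_periodic, Pi.add_apply, Pi.single_eq_same, phase_periodic hL.ne']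

/-- **Product rule for the transport amplitude**:
`∂_{0,l}(e^{ik·x₀}ψ) = e^{ik·x₀}(∂_{0,l}ψ + i k_l ψ)`. [folklore] -/
private theorem tr_fderiv_P (hL : 0 < L) (n : Fin 3 → ℤ) (Φ : PeriodicTrialState (m + 1) L)
    (hΦ : ∀ X, Φ.ψ X ≠ 0) (X : Config (m + 1)) (l : Fin 3) :
    fderiv ℝ (fun Y : Config (m + 1) => phase L n (Y 0) * (fibrePsi Φ Y : ℂ)) X
        (Pi.single 0 (EuclideanSpace.single l 1)) =
      phase L n (X 0) *
        ((dPsi Φ X l : ℂ) + 2 * Real.pi * Complex.I * (n l) / L * (fibrePsi Φ X : ℂ)) := by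
  have hψd : Differentiable ℝ (fibrePsi Φ) := (contDiff_fibrePsi hL Φ hΦ).differentiable one_ne_zero
  have h1 : HasFDerivAt (fun Y : Config (m + 1) => phase L n (Y 0))
      ((fderiv ℝ (cellWave L n) (X 0)).comp (ContinuousLinearMap.proj 0)) X := by
    have hc := ((contDiff_cellWave L n).differentiable (by simp) (X 0)).hasFDerivAt.comp X
      (hasFDerivAt_apply (𝕜 := ℝ) 0 X)
    have heq : (fun Y : Config (m + 1) => phase L n (Y 0)) = cellWave L n ∘ fun Y => Y 0 := by
      funext Y
      exact phase_eq_cellWave L n (Y 0)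
    rw [heq]
    exact hc
  have h2 : HasFDerivAt (fun Y => (fibrePsi Φ Y : ℂ))
      (Complex.ofRealCLM.comp (fderiv ℝ (fibrePsi Φ) X)) X :=
    Complex.ofRealCLM.hasFDerivAt.comp X (hψd X).hasFDerivAt
  have h12 : HasFDerivAt (fun Y : Config (m + 1) => phase L n (Y 0) * (fibrePsi Φ Y : ℂ))
      (phase L n (X 0) • Complex.ofRealCLM.comp (fderiv ℝ (fibrePsi Φ) X) +
        (fibrePsi Φ X : ℂ) • (fderiv ℝ (cellWave L n) (X 0)).comp (ContinuousLinearMap.proj 0)) X :=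
    h1.mul h2
  rw [h12.fderiv, _root_.add_apply, _root_.smul_apply, _root_.smul_apply,
    ContinuousLinearMap.comp_apply, ContinuousLinearMap.comp_apply, Complex.ofRealCLM_apply,
    smul_eq_mul, smul_eq_mul]
  have hproj : (ContinuousLinearMap.proj (R := ℝ) (φ := fun _ : Fin (m + 1) => Space) 0)
      (Pi.single 0 (EuclideanSpace.single l (1 : ℝ)) : Config (m + 1)) = EuclideanSpace.single l 1 := by
    rw [ContinuousLinearMap.proj_apply, Pi.single_eq_same]
  rw [hproj, fderiv_cellWave_apply_single, ← phase_eq_cellWave]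
  unfold dPsi
  ring

/-! ### The transport flow `J₀ = a ⊗ P` and its weak divergence -/

/-- **Weak divergence of a flow `X ↦ (a_l P(X))_l` with constant coefficients**:
`∫ Σ_l a_l P ∂_{0,l}η = -∫ (Σ_l a_l ∂_{0,l}P) η`. [folklore] -/
theorem tr_hasWeakDiv_transport (hL : 0 < L) (n : Fin 3 → ℤ)
    (Φ : PeriodicTrialState (m + 1) L) (hΦ : ∀ X, Φ.ψ X ≠ 0) (a : Fin 3 → ℂ) :
    HasWeakDiv L (fun X l => a l * (phase L n (X 0) * (fibrePsi Φ X : ℂ)))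
      (fun X => ∑ l : Fin 3, a l * (phase L n (X 0) *
        ((dPsi Φ X l : ℂ) + 2 * Real.pi * Complex.I * (n l) / L * (fibrePsi Φ X : ℂ)))) := by
  intro η hη hper
  show ∫ X in cellN (m + 1) L, ∑ l : Fin 3, a l * (phase L n (X 0) * (fibrePsi Φ X : ℂ)) *
      fderiv ℝ η X (Pi.single 0 (EuclideanSpace.single l 1)) =
    -∫ X in cellN (m + 1) L, (∑ l : Fin 3, a l * (phase L n (X 0) *
      ((dPsi Φ X l : ℂ) + 2 * Real.pi * Complex.I * (n l) / L * (fibrePsi Φ X : ℂ)))) * η X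
  have hPd := tr_contDiff_P hL n Φ hΦ
  have hψc := continuous_fibrePsi hL Φ hΦ
  have hphase : Continuous (phase L n) := (contDiff_phase L n (k := 0)).continuous
  have hd : ∀ l : Fin 3, Continuous fun X => dPsi Φ X l := continuous_dPsi hL Φ hΦ
  have hηc : Continuous η := hη.continuous
  have hdη : ∀ l : Fin 3, Continuous fun X =>
      fderiv ℝ η X (Pi.single 0 (EuclideanSpace.single l 1)) :=
    fun l => (hη.continuous_fderiv one_ne_zero).clm_apply continuous_const
  have hηp : ∀ (X : Config (m + 1)) (k : Fin 3),
      η (X + Pi.single (0 : Fin (m + 1)) (EuclideanSpace.single k L)) = η X :=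
    fun X k => hper X 0 k
  have hi1 : ∀ l : Fin 3, Integrable (fun X => a l * (phase L n (X 0) * (fibrePsi Φ X : ℂ)) *
      fderiv ℝ η X (Pi.single 0 (EuclideanSpace.single l 1)))
      (volume.restrict (cellN (m + 1) L)) := by
    intro l
    have := hdη l
    exact integrableOn_cellN (by fun_prop) L
  have hi2 : ∀ l : Fin 3, Integrable (fun X => a l * (phase L n (X 0) *
      ((dPsi Φ X l : ℂ) + 2 * Real.pi * Complex.I * (n l) / L * (fibrePsi Φ X : ℂ)) * η X))
      (volume.restrict (cellN (m + 1) L)) := by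
    intro l
    have := hd l
    exact integrableOn_cellN (by fun_prop) L
  -- one direction at a time
  have hl : ∀ l : Fin 3, ∫ X in cellN (m + 1) L, a l * (phase L n (X 0) * (fibrePsi Φ X : ℂ)) *
      fderiv ℝ η X (Pi.single 0 (EuclideanSpace.single l 1)) =
        -(a l * ∫ X in cellN (m + 1) L, phase L n (X 0) *
          ((dPsi Φ X l : ℂ) + 2 * Real.pi * Complex.I * (n l) / L * (fibrePsi Φ X : ℂ)) * η X) := by
    intro l
    simp_rw [mul_assoc (a l)]
    rw [integral_const_mul, tr_integral_mul_fderiv hL hPd hη (tr_P_periodic hL n Φ) hηp l]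
    simp_rw [tr_fderiv_P hL n Φ hΦ]
    rw [mul_neg]
  rw [integral_finsetSum _ (fun l _ => hi1 l)]
  simp_rw [hl, Finset.sum_mul]
  have e3 : ∀ X (l : Fin 3), a l * (phase L n (X 0) *
      ((dPsi Φ X l : ℂ) + 2 * Real.pi * Complex.I * (n l) / L * (fibrePsi Φ X : ℂ))) * η X =
      a l * (phase L n (X 0) *
        ((dPsi Φ X l : ℂ) + 2 * Real.pi * Complex.I * (n l) / L * (fibrePsi Φ X : ℂ)) * η X) :=
    fun X l => by ring
  simp_rw [e3]
  rw [integral_finsetSum _ (fun l _ => hi2 l), ← Finset.sum_neg_distrib]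
  refine Finset.sum_congr rfl fun l _ => ?_
  rw [integral_const_mul]

/-- `Σ_l k_l² = |k|²`, `k_l = 2πn_l/L`. [folklore] -/
private theorem tr_sum_kcomp_sq (L : ℝ) (n : Fin 3 → ℤ) :
    ∑ l : Fin 3, (2 * Real.pi * (n l : ℝ) / L) ^ 2 = ksq L n := by
  unfold ksq
  rw [Finset.mul_sum]
  refine Finset.sum_congr rfl fun l _ => ?_
  ring

/-- `|k|² > 0` for `n ≠ 0`. [folklore] -/
private theorem tr_ksq_pos (hL : 0 < L) {n : Fin 3 → ℤ} (hn : n ≠ 0) : 0 < ksq L n := by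
  obtain ⟨j, hj⟩ := Function.ne_iff.1 hn
  have h1 : (1 : ℝ) ≤ (n j : ℝ) ^ 2 := by
    have : (1 : ℤ) ≤ n j ^ 2 := by nlinarith [Int.one_le_abs hj, sq_abs (n j)]
    exact_mod_cast this
  have hs : 0 < ∑ l : Fin 3, (n l : ℝ) ^ 2 :=
    lt_of_lt_of_le one_pos (h1.trans (Finset.single_le_sum (f := fun l => (n l : ℝ) ^ 2)
      (fun i _ => sq_nonneg _) (Finset.mem_univ j)))
  unfold ksq
  positivity

/-- `‖n‖∞² ≤ |n|₂²`. [folklore] -/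
private theorem tr_norm_sq_le_sum_sq (n : Fin 3 → ℤ) :
    ‖(fun j => (n j : ℝ))‖ ^ 2 ≤ ∑ j : Fin 3, (n j : ℝ) ^ 2 := by
  -- adapted from Theorems/FibreConductance/Negative/FreeConstantFlow.lean (`norm_sq_le_nsq`)
  have h : ‖(fun j => (n j : ℝ))‖ ≤ Real.sqrt (∑ j : Fin 3, (n j : ℝ) ^ 2) := by
    refine (pi_norm_le_iff_of_nonneg (Real.sqrt_nonneg _)).2 fun j => ?_
    rw [Real.norm_eq_abs, ← Real.sqrt_sq_eq_abs]
    exact Real.sqrt_le_sqrt (Finset.single_le_sum (f := fun j => (n j : ℝ) ^ 2)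
      (fun i _ => sq_nonneg _) (Finset.mem_univ j))
  calc ‖(fun j => (n j : ℝ))‖ ^ 2 ≤ Real.sqrt (∑ j : Fin 3, (n j : ℝ) ^ 2) ^ 2 :=
        pow_le_pow_left₀ (norm_nonneg _) h 2
    _ = ∑ j : Fin 3, (n j : ℝ) ^ 2 := Real.sq_sqrt (Finset.sum_nonneg fun j _ => sq_nonneg _)

/-- **The pointwise divergence identity**: with the transport coefficients
`a_l = L^{-3/2} k_l/(i|k|²)`, `Σ_l a_l ∂_{0,l}P = q + ε♭ + ε♮`. [folklore] -/
theorem tr_div_identity (hL : 0 < L) {n : Fin 3 → ℤ} (hn : n ≠ 0)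
    (Φ : PeriodicTrialState (m + 1) L) (X : Config (m + 1)) :
    ∑ l : Fin 3, ((Real.sqrt (L ^ 3))⁻¹ : ℂ) * ((2 * Real.pi * (n l : ℝ) / L : ℝ) : ℂ) /
        (Complex.I * (ksq L n : ℂ)) * (phase L n (X 0) *
          ((dPsi Φ X l : ℂ) + 2 * Real.pi * Complex.I * (n l) / L * (fibrePsi Φ X : ℂ))) =
      ((Real.sqrt (L ^ 3))⁻¹ : ℂ) *
          (phase L n (X 0) * (fibrePsi Φ X : ℂ) - fibreBeta n Φ X * (fibrePsi Φ X : ℂ) ^ 2) +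
        gradDefect n Φ X + densDefect n Φ X := by
  have hK := tr_ksq_pos hL hn
  have hKc : (ksq L n : ℂ) ≠ 0 := by exact_mod_cast hK.ne'
  have hLc : (L : ℂ) ≠ 0 := by exact_mod_cast hL.ne'
  have hI : Complex.I ≠ 0 := Complex.I_ne_zero
  have hsum : ∑ l : Fin 3, ((2 * Real.pi * (n l : ℝ) / L : ℝ) : ℂ) *
      (2 * Real.pi * Complex.I * (n l) / L) = Complex.I * (ksq L n : ℂ) := by
    rw [← tr_sum_kcomp_sq L n]
    push_cast
    rw [Finset.mul_sum]
    refine Finset.sum_congr rfl fun l _ => ?_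
    ring
  -- split the sum into the gradient part and the transport part
  have hsplit : ∑ l : Fin 3, ((Real.sqrt (L ^ 3))⁻¹ : ℂ) * ((2 * Real.pi * (n l : ℝ) / L : ℝ) : ℂ) /
      (Complex.I * (ksq L n : ℂ)) * (phase L n (X 0) *
        ((dPsi Φ X l : ℂ) + 2 * Real.pi * Complex.I * (n l) / L * (fibrePsi Φ X : ℂ))) =
      ((Real.sqrt (L ^ 3))⁻¹ : ℂ) * phase L n (X 0) / (Complex.I * (ksq L n : ℂ)) *
        (∑ l : Fin 3, ((2 * Real.pi * (n l : ℝ) / L : ℝ) : ℂ) * (dPsi Φ X l : ℂ)) +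
      ((Real.sqrt (L ^ 3))⁻¹ : ℂ) * phase L n (X 0) * (fibrePsi Φ X : ℂ) /
          (Complex.I * (ksq L n : ℂ)) *
        (∑ l : Fin 3, ((2 * Real.pi * (n l : ℝ) / L : ℝ) : ℂ) * (2 * Real.pi * Complex.I * (n l) / L)) := by
    rw [Finset.mul_sum, Finset.mul_sum, ← Finset.sum_add_distrib]
    refine Finset.sum_congr rfl fun l _ => ?_
    ring
  rw [hsplit, hsum, div_mul_cancel₀ _ (mul_ne_zero hI hKc)]
  unfold gradDefect densDefect
  push_cast
  field_simp
  ring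

/-- **Pointwise cost of the transport flow**: `Σ_l |J₀,l|² W/ψ² = L⁻³ W/|k|²`. [folklore] -/
private theorem tr_cost_density (hL : 0 < L) {n : Fin 3 → ℤ} (hn : n ≠ 0)
    (Φ : PeriodicTrialState (m + 1) L) (hΦ : ∀ X, Φ.ψ X ≠ 0) (X : Config (m + 1)) :
    (∑ l : Fin 3, ‖((Real.sqrt (L ^ 3))⁻¹ : ℂ) * ((2 * Real.pi * (n l : ℝ) / L : ℝ) : ℂ) /
        (Complex.I * (ksq L n : ℂ)) * (phase L n (X 0) * (fibrePsi Φ X : ℂ))‖ ^ 2) *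
        fibreW Φ X / fibrePsi Φ X ^ 2 =
      (L ^ 3)⁻¹ / ksq L n * fibreW Φ X := by
  have hK := tr_ksq_pos hL hn
  have hψ := fibrePsi_pos hL Φ hΦ X
  have hL3 : 0 < L ^ 3 := by positivity
  have hl : ∀ l : Fin 3, ‖((Real.sqrt (L ^ 3))⁻¹ : ℂ) * ((2 * Real.pi * (n l : ℝ) / L : ℝ) : ℂ) /
      (Complex.I * (ksq L n : ℂ)) * (phase L n (X 0) * (fibrePsi Φ X : ℂ))‖ ^ 2 =
        (2 * Real.pi * (n l : ℝ) / L) ^ 2 * ((L ^ 3)⁻¹ / ksq L n ^ 2 * fibrePsi Φ X ^ 2) := by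
    intro l
    rw [norm_mul, norm_mul, norm_div, norm_mul, norm_mul, norm_inv, Complex.norm_I,
      Complex.norm_real, Complex.norm_real, Complex.norm_real, Complex.norm_real, norm_phase,
      Real.norm_of_nonneg (Real.sqrt_nonneg _), Real.norm_of_nonneg hK.le,
      Real.norm_of_nonneg hψ.le, Real.norm_eq_abs]
    rw [show ((Real.sqrt (L ^ 3))⁻¹ * |2 * Real.pi * (n l : ℝ) / L| / (1 * ksq L n) *
        (1 * fibrePsi Φ X)) ^ 2 = |2 * Real.pi * (n l : ℝ) / L| ^ 2 *
          ((Real.sqrt (L ^ 3) ^ 2)⁻¹ / ksq L n ^ 2 * fibrePsi Φ X ^ 2) by ring,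
      sq_abs, Real.sq_sqrt hL3.le]
  simp_rw [hl]
  rw [← Finset.sum_mul, tr_sum_kcomp_sq]
  field_simp

/-- **Cost of the transport flow**: `∫ |J₀|² W/ψ² = 1/|k|² ≤ L²/(4π²‖n‖²)`. [folklore] -/
theorem tr_cost_transport (hL : 0 < L) {n : Fin 3 → ℤ} (hn : n ≠ 0)
    (Φ : PeriodicTrialState (m + 1) L) (hΦ : ∀ X, Φ.ψ X ≠ 0) :
    fibreCost Φ (fun X l => ((Real.sqrt (L ^ 3))⁻¹ : ℂ) * ((2 * Real.pi * (n l : ℝ) / L : ℝ) : ℂ) /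
        (Complex.I * (ksq L n : ℂ)) * (phase L n (X 0) * (fibrePsi Φ X : ℂ))) ≤
      ENNReal.ofReal (1 / (4 * Real.pi ^ 2) * L ^ 2 / ‖(fun j => (n j : ℝ))‖ ^ 2) := by
  have hK := tr_ksq_pos hL hn
  have hL3 : 0 < L ^ 3 := by positivity
  unfold fibreCost
  simp_rw [tr_cost_density hL hn Φ hΦ]
  have h1 : ∀ X, ENNReal.ofReal ((L ^ 3)⁻¹ / ksq L n * fibreW Φ X) =
      ENNReal.ofReal ((L ^ 3)⁻¹ / ksq L n) * ENNReal.ofReal (fibreW Φ X) := fun X =>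
    ENNReal.ofReal_mul (by positivity)
  simp_rw [h1]
  rw [lintegral_const_mul _ (measurable_fibreW Φ).ennreal_ofReal, lintegral_cellN_fibreW hL,
    ← ENNReal.ofReal_mul (by positivity)]
  apply ENNReal.ofReal_le_ofReal
  rw [show (L ^ 3)⁻¹ / ksq L n * L ^ 3 = 1 / ksq L n by field_simp]
  have hnn : 0 < ‖(fun j => (n j : ℝ))‖ := lt_of_lt_of_le one_pos (one_le_norm_intVec hn)
  unfold ksq
  rw [div_le_div_iff₀ (by unfold ksq at hK; exact hK) (by positivity), one_mul]
  have h := tr_norm_sq_le_sum_sq n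
  have hπ : 0 < Real.pi := Real.pi_pos
  calc ‖(fun j => (n j : ℝ))‖ ^ 2 = 1 / (4 * Real.pi ^ 2) * L ^ 2 *
        ((2 * Real.pi / L) ^ 2 * ‖(fun j => (n j : ℝ))‖ ^ 2) := by field_simp; ring
    _ ≤ 1 / (4 * Real.pi ^ 2) * L ^ 2 * ((2 * Real.pi / L) ^ 2 * ∑ j : Fin 3, (n j : ℝ) ^ 2) := by
        gcongr

end Summit.AtomisticToContinuum.BoseEinsteinCondensation.Cruxes.FibreConductance.ParsevalShellBootstrap

end
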